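import Mathlib
import Literature.Analysis.FluidPDE.Tao2016AveragedNS.ShiftSetCascadeFlows
import Literature.Analysis.FluidPDE.Tao2016AveragedNS.ShiftSetCascadeFlux
import Literature.Analysis.FluidPDE.Tao2016AveragedNS.WeightedLatticeFlowsOn
import Summits.NavierStokesRegularity.NavierStokesRegularity.Theorems.TaoLadderRungTwoFlatCertificateGlueGapDataOn
import Summits.NavierStokesRegularity.NavierStokesRegularity.Theorems.TaoLadderRungTwoFlatCertificateGlueWindowBlowupOn
import Summits.NavierStokesRegularity.NavierStokesRegularity.Theorems.TaoLadderRungTwoFlatCertificateGluePiecewiseGaussianOn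
import Summits.NavierStokesRegularity.NavierStokesRegularity.Theorems.TaoLadderRungTwoFlatGappedFrontRobustDeviationOn
import Summits.NavierStokesRegularity.NavierStokesRegularity.Theorems.TaoLadderRungTwoFlatMirrorTableDefs
import HarnessLib

/-!
# Certificate glue on a shift set `𝕊`, VII: THE WRAPPER IN THE SHAPE OF THE REGISTERED STUBS — a window
  certificate with the piecewise-Gaussian weight gives `GapData₂On ∧ TailThin` (any admissible `𝕊`, any
  `ε₀ ∈ (0,1]`), and the literal `stub_rung_quarter` shape for the mirror-seeded Toda table on `S♭` at
  `ε₀ = 1/4` (helper for item stmt-NavierStokesRegularity-22987 `FlatGapCertificatesV2`, crux K_A♭ of route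
  TaoLadderRungTwoFlat; cell harvest/h2-tao-ladder, p1 g13)

* `gapData₂On_pgw_of_windowCertificate` — glue IV (`gapData₂On_of_windowCertificate`) with every `∀k` WEIGHT
  hypothesis discharged for the weight family of the registered stubs (`w_k = C_w 2^{k²/2+bk}`, `k ≥ 0`;
  `w_k = C_w`, `k < 0`; `C_w ≥ 1`, `b ≥ 1/2`) by glue VI-b, and the Banach-space weight chosen as
  `ω_k = w_{k-1}` (admissible with `A = 96 + 2^{(9/2-b)²/2+2b}`, `D = 2^{57}`, `Ω = w_{Ka-1}` by glue V/VI-b). What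
  is left to a certificate: the window data and its three dynamical clauses, the wake/quiet-tail SCALAR
  statics, and the shape constants.
* `stub_rung_quarter_of_windowCertificate` — the instance `𝕊 = S♭`, `m = 2`, `α = mirrorTable (1/2) (1/2)`
  (class `E(S♭,4)`, `TaoLadderRungTwoFlatMirrorTableDefs`), `i₀ = 0`, `ε₀ = 1/4`, `Cα = 28`, concluding
  LITERALLY the registered stub `stub_rung_quarter` of K_A♭ (skeleton birth_KA_quarter.lean, sha16
  630a5700be442b76): `∃ σ X₀ Z w r ρ θ₀ θ c₀ c env₀, X₀ 0 ≠ 0 ∧ GapData₂On shiftSetFlat σ (1/4) 0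
  (mirrorTable (1/2) (1/2)) X₀ Z w … ∧ TailThin (1/4) w r ∧ ∃ Cw b, 1 ≤ Cw ∧ 1/2 ≤ b ∧ ∀ k ≥ 0, w k = Cw·2^{k²/2+bk}`.
  So the ε₀ = 1/4 frontier rung of the flat line is now EXACTLY a finite window certificate (theory-1's
  NUM-T28/T29/T31/T33 objects, to be re-done in kernel-checkable arithmetic) plus finitely many scalar checks.

HONEST FRAMING: Tao-type MODEL lattices; the certificate is a HYPOTHESIS — nothing is certified here and no
stub is closed by this file; nothing here is a statement about the Navier–Stokes equations.
-/

noncomputable section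

-- the sub-problem namespace repeats the summit name by design (D-0017)
set_option linter.dupNamespace false

namespace Summit.NavierStokesRegularity.NavierStokesRegularity.Theorems

open Set Filter Topology MeasureTheory intervalIntegral Literature.Analysis.FluidPDE
  Literature.Analysis.FluidPDE.TaoCascade
open Summit.NavierStokesRegularity.NavierStokesRegularity.Theorems.GappedFrontRobustOn

namespace CertificateGlueOn

variable {m : ℕ} {𝕊 : Finset (ℤ × ℤ × ℤ)}

/-- **WINDOW CERTIFICATE WITH THE PIECEWISE-GAUSSIAN WEIGHT ⇒ FORMAT-A♭ GAP DATA** (glue IV with the weight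
statics discharged; see the module docstring). [cite: Tao2016AveragedNS, §6.3–6.4 Props. 6.4–6.5 (statement shape of a renormalisation certificate); §4 Lemma 4.1 (4.5), (4.8)–(4.10)] -/
theorem gapData₂On_pgw_of_windowCertificate (h𝕊 : IsNearestNeighbourSet 𝕊) (h𝕊c : IsSlotClosed 𝕊)
    (h111 : ((1 : ℤ), (1 : ℤ), (1 : ℤ)) ∉ 𝕊) {ε₀ R : ℝ} (hε : 0 < ε₀) (hε1 : ε₀ ≤ 1)
    {α : Fin m → Fin m → Fin m → ℤ × ℤ × ℤ → ℝ} (hα : InTableClassOn 𝕊 R α)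
    {Cα : ℝ} (hCα0 : 0 ≤ Cα) (hCα : ∀ i, ∑ i₁, ∑ i₂, ∑ μ ∈ 𝕊, |α i₁ i₂ i μ| ≤ Cα)
    {i₀ : Fin m} {X₀ : Fin m → ℝ}
    -- window, weights, radius, contraction, exponents, clocks, slack
    {Kb Ka : ℤ} (hKb : 0 ≤ Kb) (hKa : 1 ≤ Ka) {Core : (Fin m → ℤ → ℝ) → Prop} {M w : ℤ → ℝ}
    {r ρ θ₀ θ c₀ c σ : ℝ} (hr : 0 < r) (hρ : 0 ≤ ρ) (hρ1 : ρ < 1) (hθ₀ : 0 ≤ θ₀) (hθ₀θ : θ₀ < θ)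
    (hθ : θ ≤ 1 / 2) (hc₀ : 0 < c₀) (hc₀c : c₀ < c) (hσ : 0 < σ)
    {Mmax : ℝ} (hMmax : ∀ k, -Kb ≤ k → k ≤ Ka → M k ≤ Mmax)
    (hcore : ∀ z z' : Fin m → ℤ → ℝ, (∀ i k, -Kb ≤ k → k ≤ Ka → z i k = z' i k) → Core z → Core z')
    (hdatum : Core (datumState i₀ X₀))
    -- wake side
    {Zb Zf : ℤ → ℝ} {Zmin Dmax Czb : ℝ} (hZf : ∀ j, j ≤ -Kb → 0 < Zf j) (hZmin : 0 < Zmin)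
    (hZmin' : ∀ j, j < -Kb → Zmin ≤ Zf j) (hZb0 : ∀ j, j < -Kb → 0 ≤ Zb j)
    (hZbf : ∀ j, j < -Kb → Zb j + r / w j ≤ Zf j / 2) (hMZf : M (-Kb) ≤ Zf (-Kb))
    (hcloseB : ∀ j, j < -Kb →
      c * (8 * Cα * (1 + ε₀) ^ ((5 : ℝ) * j / 2) *
        max (Zf (j - 1)) (max (Zf j) (Zf (j + 1))) * max (Zf (j - 1)) (max (Zf j) (Zf (j + 1))) + 0) ≤
        Zf j / 2)
    (hDmax : ∀ j, j < -Kb →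
      c * (8 * Cα * (1 + ε₀) ^ ((5 : ℝ) * j / 2) *
        max (Zf (j - 1)) (max (Zf j) (Zf (j + 1))) * max (Zf (j - 1)) (max (Zf j) (Zf (j + 1)))) ≤ Dmax)
    (hshiftB : ∀ j, j < -Kb →
      (1 + ε₀) ^ θ₀ * (Zb j + r / w j + c * (8 * Cα * (1 + ε₀) ^ ((5 : ℝ) * j / 2) *
        max (Zf (j - 1)) (max (Zf j) (Zf (j + 1))) * max (Zf (j - 1)) (max (Zf j) (Zf (j + 1))))) ≤
        Zb (j - 1))
    -- quiet side
    {ν : ℤ → ℝ} {ϑ νmax : ℝ}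
    (hcoreTop : ∀ z, Core z → ∀ i, 4 * (w Ka * |z i Ka|) ≤ r)
    (hthin : ∀ K : ℤ, Ka + 1 ≤ K →
      (1 + ε₀) ^ ((5 : ℝ) * K / 2) * r * w (K - 1) ≤ ϑ * w (K - 2) ^ 2)
    (hν : ∀ K : ℤ, Ka ≤ K → 0 ≤ ν K) (hνmax : ∀ K : ℤ, Ka ≤ K → ν K ≤ νmax)
    (hcloseA : ∀ K : ℤ, Ka + 1 ≤ K →
      2 * (Real.sqrt 2 * Real.sqrt (4 / 3 * m * (25 / 32 + 0 * (1 + ε₀) ^ ((2 : ℝ) * K))) /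
          (2 * (1 + ε₀) ^ ((K - 1 : ℤ) : ℝ)) +
        coeffAbsOn (botShifts 𝕊) α * c * (ϑ / (1 + ε₀) ^ ((5 : ℝ) / 2)) * ν (K - 1) ^ 2) ≤ ν K)
    (hslowA : ∀ K : ℤ, Ka + 1 ≤ K →
      (1 + ε₀) ^ ((5 : ℝ) * (K - 1 : ℤ) / 2) * coeffAbsOn (botShifts 𝕊) α * c *
        (ν (K - 1) * r / w (K - 2)) ≤ 1 / 2)
    (hMν : M Ka ≤ ν Ka * r / w (Ka - 1))
    (hshiftA : ∀ k : ℤ, Ka < k → ν (k + 1) * (1 + ε₀) ^ θ₀ ≤ ρ)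
    -- the certificate's interior, trapping and landing clauses
    (hinside : ∀ (z S₀ : Fin m → ℤ → ℝ), Core z →
      (∀ i k, -Kb ≤ k → k ≤ Ka → w k * |S₀ i k - z i k| ≤ r) → ∀ i k, -Kb ≤ k → k ≤ Ka → |S₀ i k| < M k)
    (htrap : ∀ (s : ℝ) (z : Fin m → ℤ → ℝ) (S : Fin m → ℤ → ℝ → ℝ), Core z → 0 < s → s ≤ c →
      (∀ i k, -Kb ≤ k → k ≤ Ka → w k * |S i k 0 - z i k| ≤ r) →
      (∀ i k, -Kb ≤ k → k ≤ Ka → ∀ u ∈ Icc 0 s,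
        HasDerivWithinAt (S i k) (quadTermOn 𝕊 ε₀ α S i k u) (Icc 0 s) u) →
      (∀ i, ContinuousOn (S i (-Kb - 1)) (Icc 0 s)) → (∀ i, ContinuousOn (S i (Ka + 1)) (Icc 0 s)) →
      (∀ i, ∀ u ∈ Icc 0 s, |S i (-Kb - 1) u| ≤ Zf (-Kb - 1)) →
      (∀ i, ∀ u ∈ Icc 0 s, |S i (Ka + 1) u| ≤ ν (Ka + 1) * r / w Ka) →
      (∀ i k, -Kb ≤ k → k ≤ Ka → ∀ u ∈ Icc 0 s, |S i k u| ≤ M k) →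
        ∀ i k, -Kb ≤ k → k ≤ Ka → ∀ u ∈ Icc 0 s, |S i k u| < M k)
    (hland : ∀ (z : Fin m → ℤ → ℝ) (S : Fin m → ℤ → ℝ → ℝ), Core z →
      (∀ i k, -Kb ≤ k → k ≤ Ka → w k * |S i k 0 - z i k| ≤ r) →
      (∀ i k, -Kb ≤ k → k ≤ Ka → ∀ u ∈ Icc 0 c₀,
        HasDerivWithinAt (S i k) (quadTermOn 𝕊 ε₀ α S i k u) (Icc 0 c₀) u) →
      (∀ i, ContinuousOn (S i (-Kb - 1)) (Icc 0 c₀)) → (∀ i, ContinuousOn (S i (Ka + 1)) (Icc 0 c₀)) →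
      (∀ i, ∀ u ∈ Icc 0 c₀, |S i (-Kb - 1) u| ≤ Zf (-Kb - 1)) →
      (∀ i, ∀ u ∈ Icc 0 c₀, |S i (Ka + 1) u| ≤ ν (Ka + 1) * r / w Ka) →
      (∀ i k, -Kb ≤ k → k ≤ Ka → ∀ u ∈ Icc 0 c₀, |S i k u| ≤ M k) →
        ∃ (τ₁ a : ℝ) (z' : Fin m → ℤ → ℝ), 0 < τ₁ ∧ τ₁ ≤ c₀ ∧ 0 < a ∧ (1 + ε₀) ^ (-θ₀) ≤ a ∧
          (1 + σ) * a ≤ |S i₀ 1 τ₁| ∧ Core z' ∧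
          (∀ i k, -Kb ≤ k → k + 1 ≤ Ka → w k * |S i (1 + k) τ₁ / a - z' i k| ≤ ρ * r) ∧
          (∀ (i : Fin m) (v : ℝ), |v| ≤ ν (Ka + 1) * r / w Ka → w Ka * |v / a - z' i Ka| ≤ ρ * r) ∧
          (∀ i, |S i (-Kb) τ₁| ≤ a * Zb (-Kb - 1)))
    (hCzb : 0 ≤ Czb) (hZbt : ∀ j, j < -Kb → Zb j ≤ Czb * (1 + ε₀) ^ (-(j : ℝ)))
    -- the piecewise-Gaussian weight
    {Cw b : ℝ} (hCw : 1 ≤ Cw) (hb : 1 / 2 ≤ b)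
    (hwp : ∀ k : ℤ, 0 ≤ k → w k = Cw * (2 : ℝ) ^ ((k : ℝ) ^ 2 / 2 + b * k))
    (hwn : ∀ k : ℤ, k < 0 → w k = Cw) :
    GapData₂On 𝕊 σ ε₀ i₀ α X₀
        {z : Fin m → ℤ → ℝ | Core z ∧ (∀ i j, j < -Kb → |z i j| ≤ Zb j) ∧
          (∀ i k, Ka < k → z i k = 0) ∧ ∃ C : ℝ, ∀ i k, |z i k| ≤ C}
        w r ρ θ₀ θ c₀ c
        (fun k => if k < -Kb then (1 / 2) * Zf k ^ 2
          else if Ka < k then (1 / 2) * (ν k * r / w (k - 1)) ^ 2 else (1 / 2) * M k ^ 2) ∧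
      TailThin ε₀ w r := by
  have hε0 : 0 ≤ ε₀ := hε.le
  have hq : 0 < 1 + ε₀ := by linarith
  -- weight statics (glue VI-b)
  have hw1 : ∀ k, 1 ≤ w k := pgw_one_le hCw hb hwp hwn
  have hT1 : ∀ k : ℤ, Ka ≤ k → 2 * (1 + ε₀) ^ (k : ℝ) * w k ≤ w (k + 1) :=
    fun k hk => pgw_T1 hε0 hε1 hCw hb hwp k (by omega)
  have hthinW : TailThin ε₀ w r := pgw_tailThin hε0 hε1 hr.le hCw hwp
  have hCt : 0 ≤ Cw + Czb := by linarith
  have hZbt' : ∀ j, j < -Kb → Zb j ≤ (Cw + Czb) * (1 + ε₀) ^ (-(j : ℝ)) := fun j hj =>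
    (hZbt j hj).trans (mul_le_mul_of_nonneg_right (by linarith) (Real.rpow_pos_of_pos hq _).le)
  have hwt : ∀ k : ℤ, k ≤ 0 → w k ≤ (Cw + Czb) * (1 + ε₀) ^ (-(k : ℝ)) := fun k hk =>
    (pgw_tame hε0 hwp hwn hCw k hk).trans
      (mul_le_mul_of_nonneg_right (by linarith) (Real.rpow_pos_of_pos hq _).le)
  -- the Banach-space weight ω_k = w_{k-1}
  have hωpos : ∀ k, 0 < (fun k : ℤ => w (k - 1)) k := fun k => lt_of_lt_of_le one_pos (hw1 (k - 1))
  have hA₃ : (0 : ℝ) ≤ (2 : ℝ) ^ ((9 / 2 - b) ^ 2 / 2 + 2 * b) := Real.rpow_nonneg zero_le_two _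
  have hω : WeightRatiosLEOn 𝕊 ε₀ (fun k : ℤ => w (k - 1))
      (32 + 32 * 1 + 32 * 1 ^ 2 + (2 : ℝ) ^ ((9 / 2 - b) ^ 2 / 2 + 2 * b)) :=
    weightRatiosLEOn_of_nearestNeighbour h𝕊 hq hωpos (by norm_num) zero_le_one hA₃
      (pgw_shift_ratio_same hε0 hε1 hCw hb hwp hwn (ω := fun k : ℤ => w (k - 1)) fun k => rfl)
      (pgw_shift_ratio_back hCw hb hwp hwn (ω := fun k : ℤ => w (k - 1)) fun k => rfl)
      (pgw_shift_ratio_pump hε0 hε1 hCw hb hwp hwn (ω := fun k : ℤ => w (k - 1)) fun k => rfl)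
  have hA : (0 : ℝ) ≤ 32 + 32 * 1 + 32 * 1 ^ 2 + (2 : ℝ) ^ ((9 / 2 - b) ^ 2 / 2 + 2 * b) := by positivity
  have hD : ∀ k : ℤ, (1 + (1 + ε₀) ^ ((10 : ℝ) * k)) / (fun k : ℤ => w (k - 1)) k ≤ (2 : ℝ) ^ (57 : ℝ) :=
    pgw_shift_apriori hε0 hε1 hCw hb hwp hwn (ω := fun k : ℤ => w (k - 1)) fun k => rfl
  have hΩ : 0 ≤ w (Ka - 1) := le_trans zero_le_one (hw1 _)
  have hωlow : ∀ k, k ≤ Ka → (fun k : ℤ => w (k - 1)) k ≤ w (Ka - 1) :=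
    fun k hk => pgw_shift_low hCw hb hwp hwn (ω := fun k : ℤ => w (k - 1)) (fun k => rfl) k hk
  have hωhigh : ∀ k, Ka < k → (fun k : ℤ => w (k - 1)) k ≤ w (Ka - 1) * w (k - 1) :=
    fun k _ => pgw_shift_high hCw hb hwp hwn (ω := fun k : ℤ => w (k - 1)) (fun k => rfl) k
  exact gapData₂On_of_windowCertificate h𝕊 h𝕊c h111 hε hα hCα0 hCα hKb hKa hr hρ hρ1 hθ₀ hθ₀θ hθ hc₀
    hc₀c hσ hw1 hMmax hcore hdatum hZf hZmin hZmin' hZb0 hZbf hMZf hcloseB hDmax hshiftB hCt hZbt' hwt hT1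
    hcoreTop hthin hthinW hν hνmax hcloseA hslowA hMν hshiftA hinside htrap hland hω hA hD hΩ hωlow hωhigh

/-- **THE REGISTERED STUB `stub_rung_quarter` FROM A WINDOW CERTIFICATE** (`S♭`, `m = 2`,
`α = mirrorTable (1/2) (1/2) ∈ E(S♭, 4)`, `i₀ = 0`, `ε₀ = 1/4`, row sums `≤ 28`; piecewise-Gaussian weight):
the conclusion is LITERALLY the registered stub's statement (skeleton birth_KA_quarter.lean, theory-1 g16).
[cite: Tao2016AveragedNS, §6.3–6.4 Props. 6.4–6.5 (statement shape of a renormalisation certificate); route TaoLadderRungTwoFlat, crux K_A♭, stub_rung_quarter] -/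
theorem stub_rung_quarter_of_windowCertificate {X₀ : Fin 2 → ℝ} (hX₀ : X₀ 0 ≠ 0)
    -- window, weights, radius, contraction, exponents, clocks, slack
    {Kb Ka : ℤ} (hKb : 0 ≤ Kb) (hKa : 1 ≤ Ka) {Core : (Fin 2 → ℤ → ℝ) → Prop} {M w : ℤ → ℝ}
    {r ρ θ₀ θ c₀ c σ : ℝ} (hr : 0 < r) (hρ : 0 ≤ ρ) (hρ1 : ρ < 1) (hθ₀ : 0 ≤ θ₀) (hθ₀θ : θ₀ < θ)
    (hθ : θ ≤ 1 / 2) (hc₀ : 0 < c₀) (hc₀c : c₀ < c) (hσ : 0 < σ)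
    {Mmax : ℝ} (hMmax : ∀ k, -Kb ≤ k → k ≤ Ka → M k ≤ Mmax)
    (hcore : ∀ z z' : Fin 2 → ℤ → ℝ, (∀ i k, -Kb ≤ k → k ≤ Ka → z i k = z' i k) → Core z → Core z')
    (hdatum : Core (datumState (0 : Fin 2) X₀))
    -- wake side
    {Zb Zf : ℤ → ℝ} {Zmin Dmax Czb : ℝ} (hZf : ∀ j, j ≤ -Kb → 0 < Zf j) (hZmin : 0 < Zmin)
    (hZmin' : ∀ j, j < -Kb → Zmin ≤ Zf j) (hZb0 : ∀ j, j < -Kb → 0 ≤ Zb j)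
    (hZbf : ∀ j, j < -Kb → Zb j + r / w j ≤ Zf j / 2) (hMZf : M (-Kb) ≤ Zf (-Kb))
    (hcloseB : ∀ j, j < -Kb →
      c * (8 * 28 * (1 + (1 / 4 : ℝ)) ^ ((5 : ℝ) * j / 2) *
        max (Zf (j - 1)) (max (Zf j) (Zf (j + 1))) * max (Zf (j - 1)) (max (Zf j) (Zf (j + 1))) + 0) ≤
        Zf j / 2)
    (hDmax : ∀ j, j < -Kb →
      c * (8 * 28 * (1 + (1 / 4 : ℝ)) ^ ((5 : ℝ) * j / 2) *
        max (Zf (j - 1)) (max (Zf j) (Zf (j + 1))) * max (Zf (j - 1)) (max (Zf j) (Zf (j + 1)))) ≤ Dmax)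
    (hshiftB : ∀ j, j < -Kb →
      (1 + (1 / 4 : ℝ)) ^ θ₀ * (Zb j + r / w j + c * (8 * 28 * (1 + (1 / 4 : ℝ)) ^ ((5 : ℝ) * j / 2) *
        max (Zf (j - 1)) (max (Zf j) (Zf (j + 1))) * max (Zf (j - 1)) (max (Zf j) (Zf (j + 1))))) ≤
        Zb (j - 1))
    -- quiet side
    {ν : ℤ → ℝ} {ϑ νmax : ℝ}
    (hcoreTop : ∀ z, Core z → ∀ i, 4 * (w Ka * |z i Ka|) ≤ r)
    (hthin : ∀ K : ℤ, Ka + 1 ≤ K →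
      (1 + (1 / 4 : ℝ)) ^ ((5 : ℝ) * K / 2) * r * w (K - 1) ≤ ϑ * w (K - 2) ^ 2)
    (hν : ∀ K : ℤ, Ka ≤ K → 0 ≤ ν K) (hνmax : ∀ K : ℤ, Ka ≤ K → ν K ≤ νmax)
    (hcloseA : ∀ K : ℤ, Ka + 1 ≤ K →
      2 * (Real.sqrt 2 * Real.sqrt (4 / 3 * (2 : ℝ) * (25 / 32 + 0 * (1 + (1 / 4 : ℝ)) ^ ((2 : ℝ) * K))) /
          (2 * (1 + (1 / 4 : ℝ)) ^ ((K - 1 : ℤ) : ℝ)) +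
        coeffAbsOn (botShifts shiftSetFlat) (mirrorTable (1 / 2) (1 / 2)) * c * (ϑ / (1 + (1 / 4 : ℝ)) ^ ((5 : ℝ) / 2)) * ν (K - 1) ^ 2) ≤ ν K)
    (hslowA : ∀ K : ℤ, Ka + 1 ≤ K →
      (1 + (1 / 4 : ℝ)) ^ ((5 : ℝ) * (K - 1 : ℤ) / 2) * coeffAbsOn (botShifts shiftSetFlat) (mirrorTable (1 / 2) (1 / 2)) * c *
        (ν (K - 1) * r / w (K - 2)) ≤ 1 / 2)
    (hMν : M Ka ≤ ν Ka * r / w (Ka - 1))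
    (hshiftA : ∀ k : ℤ, Ka < k → ν (k + 1) * (1 + (1 / 4 : ℝ)) ^ θ₀ ≤ ρ)
    -- the certificate's interior, trapping and landing clauses
    (hinside : ∀ (z S₀ : Fin 2 → ℤ → ℝ), Core z →
      (∀ i k, -Kb ≤ k → k ≤ Ka → w k * |S₀ i k - z i k| ≤ r) → ∀ i k, -Kb ≤ k → k ≤ Ka → |S₀ i k| < M k)
    (htrap : ∀ (s : ℝ) (z : Fin 2 → ℤ → ℝ) (S : Fin 2 → ℤ → ℝ → ℝ), Core z → 0 < s → s ≤ c →
      (∀ i k, -Kb ≤ k → k ≤ Ka → w k * |S i k 0 - z i k| ≤ r) →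
      (∀ i k, -Kb ≤ k → k ≤ Ka → ∀ u ∈ Icc 0 s,
        HasDerivWithinAt (S i k) (quadTermOn shiftSetFlat (1 / 4) (mirrorTable (1 / 2) (1 / 2)) S i k u) (Icc 0 s) u) →
      (∀ i, ContinuousOn (S i (-Kb - 1)) (Icc 0 s)) → (∀ i, ContinuousOn (S i (Ka + 1)) (Icc 0 s)) →
      (∀ i, ∀ u ∈ Icc 0 s, |S i (-Kb - 1) u| ≤ Zf (-Kb - 1)) →
      (∀ i, ∀ u ∈ Icc 0 s, |S i (Ka + 1) u| ≤ ν (Ka + 1) * r / w Ka) →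
      (∀ i k, -Kb ≤ k → k ≤ Ka → ∀ u ∈ Icc 0 s, |S i k u| ≤ M k) →
        ∀ i k, -Kb ≤ k → k ≤ Ka → ∀ u ∈ Icc 0 s, |S i k u| < M k)
    (hland : ∀ (z : Fin 2 → ℤ → ℝ) (S : Fin 2 → ℤ → ℝ → ℝ), Core z →
      (∀ i k, -Kb ≤ k → k ≤ Ka → w k * |S i k 0 - z i k| ≤ r) →
      (∀ i k, -Kb ≤ k → k ≤ Ka → ∀ u ∈ Icc 0 c₀,
        HasDerivWithinAt (S i k) (quadTermOn shiftSetFlat (1 / 4) (mirrorTable (1 / 2) (1 / 2)) S i k u) (Icc 0 c₀) u) →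
      (∀ i, ContinuousOn (S i (-Kb - 1)) (Icc 0 c₀)) → (∀ i, ContinuousOn (S i (Ka + 1)) (Icc 0 c₀)) →
      (∀ i, ∀ u ∈ Icc 0 c₀, |S i (-Kb - 1) u| ≤ Zf (-Kb - 1)) →
      (∀ i, ∀ u ∈ Icc 0 c₀, |S i (Ka + 1) u| ≤ ν (Ka + 1) * r / w Ka) →
      (∀ i k, -Kb ≤ k → k ≤ Ka → ∀ u ∈ Icc 0 c₀, |S i k u| ≤ M k) →
        ∃ (τ₁ a : ℝ) (z' : Fin 2 → ℤ → ℝ), 0 < τ₁ ∧ τ₁ ≤ c₀ ∧ 0 < a ∧ (1 + (1 / 4 : ℝ)) ^ (-θ₀) ≤ a ∧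
          (1 + σ) * a ≤ |S 0 1 τ₁| ∧ Core z' ∧
          (∀ i k, -Kb ≤ k → k + 1 ≤ Ka → w k * |S i (1 + k) τ₁ / a - z' i k| ≤ ρ * r) ∧
          (∀ (i : Fin 2) (v : ℝ), |v| ≤ ν (Ka + 1) * r / w Ka → w Ka * |v / a - z' i Ka| ≤ ρ * r) ∧
          (∀ i, |S i (-Kb) τ₁| ≤ a * Zb (-Kb - 1)))
    (hCzb : 0 ≤ Czb) (hZbt : ∀ j, j < -Kb → Zb j ≤ Czb * (1 + (1 / 4 : ℝ)) ^ (-(j : ℝ)))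
    -- the piecewise-Gaussian weight
    {Cw b : ℝ} (hCw : 1 ≤ Cw) (hb : 1 / 2 ≤ b)
    (hwp : ∀ k : ℤ, 0 ≤ k → w k = Cw * (2 : ℝ) ^ ((k : ℝ) ^ 2 / 2 + b * k))
    (hwn : ∀ k : ℤ, k < 0 → w k = Cw) :
    ∃ (σ : ℝ) (X₀ : Fin 2 → ℝ) (Z : Set (Fin 2 → ℤ → ℝ)) (w : ℤ → ℝ) (r ρ θ₀ θ c₀ c : ℝ) (env₀ : ℤ → ℝ),
      X₀ 0 ≠ 0 ∧
        GapData₂On shiftSetFlat σ (1 / 4) (0 : Fin 2) (mirrorTable (1 / 2) (1 / 2)) X₀ Z w r ρ θ₀ θ c₀ c env₀ ∧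
          TailThin (1 / 4) w r ∧
            ∃ (Cw b : ℝ), 1 ≤ Cw ∧ 1 / 2 ≤ b ∧ ∀ k : ℤ, 0 ≤ k → w k = Cw * (2 : ℝ) ^ ((k : ℝ) ^ 2 / 2 + b * k) := by
  have hα : InTableClassOn shiftSetFlat 4 (mirrorTable (1 / 2) (1 / 2)) := inTableClassOn_mirrorTable_half
  have hα1 : ∀ (i₁ i₂ i₃ : Fin 2) (μ : ℤ × ℤ × ℤ), μ ∈ shiftSetFlat → |mirrorTable (1 / 2) (1 / 2) i₁ i₂ i₃ μ| ≤ 1 :=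
    fun i₁ i₂ i₃ μ hμ => (hα.2.2.1 i₁ i₂ i₃ μ hμ).1
  have hCα : ∀ i : Fin 2, ∑ i₁, ∑ i₂, ∑ μ ∈ shiftSetFlat, |mirrorTable (1 / 2) (1 / 2) i₁ i₂ i μ| ≤ 28 := by
    intro i
    refine (sum_abs_coeffOn_le (𝕊 := shiftSetFlat) hα1 i).trans ?_
    rw [card_shiftSetFlat]
    norm_num
  have hcloseA' : ∀ K : ℤ, Ka + 1 ≤ K →
      2 * (Real.sqrt 2 * Real.sqrt (4 / 3 * ((2 : ℕ) : ℝ) * (25 / 32 + 0 * (1 + (1 / 4 : ℝ)) ^ ((2 : ℝ) * K))) /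
          (2 * (1 + (1 / 4 : ℝ)) ^ ((K - 1 : ℤ) : ℝ)) +
        coeffAbsOn (botShifts shiftSetFlat) (mirrorTable (1 / 2) (1 / 2)) * c *
          (ϑ / (1 + (1 / 4 : ℝ)) ^ ((5 : ℝ) / 2)) * ν (K - 1) ^ 2) ≤ ν K := by
    intro K hK
    have h := hcloseA K hK
    norm_num at h ⊢
    exact h
  obtain ⟨hgap, hthin'⟩ := gapData₂On_pgw_of_windowCertificate isNearestNeighbourSet_shiftSetFlat
    isSlotClosed_shiftSetFlat not_mem_shiftSetFlat_one_one_one (by norm_num : (0 : ℝ) < 1 / 4)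
    (by norm_num : (1 / 4 : ℝ) ≤ 1) hα (by norm_num : (0 : ℝ) ≤ 28) hCα (i₀ := 0) (X₀ := X₀) hKb hKa hr hρ
    hρ1 hθ₀ hθ₀θ hθ hc₀ hc₀c hσ hMmax hcore hdatum hZf hZmin hZmin' hZb0 hZbf hMZf hcloseB hDmax hshiftB
    hcoreTop hthin hν hνmax hcloseA' hslowA hMν hshiftA hinside htrap hland hCzb hZbt hCw hb hwp hwn
  exact ⟨σ, X₀, _, w, r, ρ, θ₀, θ, c₀, c, _, hX₀, hgap, hthin', Cw, b, hCw, hb, hwp⟩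

end CertificateGlueOn

end Summit.NavierStokesRegularity.NavierStokesRegularity.Theorems

end
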